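import Summits.CriticalPhenomena.SAWScalingLimit.Theorems.SAWDevelopingMapHexConjectureWindowLocalityOfArchTightness
import HarnessLib

/-!
# Crux `HexConjecture` (stmt-CriticalPhenomena-0808), line `root-locality-replaces-loewner`:
a common tail exponent of the half-plane arch measure implies WINDOW-AVERAGED arch locality

Landing target:
`Summits/CriticalPhenomena/SAWScalingLimit/Theorems/SAWDevelopingMapHexConjectureWindowLocalityOfTailExponent.lean`
(`--supports stmt-CriticalPhenomena-0808`; lead continuation prover-line-stmt-CriticalPhenomena-0808-c5-0).

Notation.  For a cell `x : Site 2` let `s_x = {(x - e₁, 1), (x, 0)}` be its vertical floor mid-edge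
and, for an offset `d : ℤ`, `t_d = {(x + d e₀ - e₁, 1), (x + d e₀, 0)}` the floor mid-edge of the
cell `x + d e₀` of the same row.  For a finite `Λ` write
`FarMass^T_Λ(s_x → t_d) = Σ_{γ ⊂ Λ : s_x → t_d, γ reaches distance ≥ T from mid s_x} x_c^{ℓ(γ)}` and
`Z_B(s_x → t_d) = Σ_{γ ⊂ B : s_x → t_d} x_c^{ℓ(γ)}` (`x_c = hexCriticalFugacity`).

The c5 reshape of the line consumes the *window-averaged arch locality* (WAL): for every `η > 0`
there is `θb > 0` such that for all `0 < θ₀ ≤ θb` there are `0 < θ₁ < θ₀` and `R₀ > 0` with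
`Σ_{d ∈ S} FarMass^R_Λ(s_x → t_d) ≤ η · Σ_{d ∈ S} Z_B(s_x → t_d)` for all `R ≥ R₀`, every finite
`Λ` in the rows `≥ x₁`, `B` the part of the rows `≥ x₁` within distance `R` of `mid s_x`, and `S`
the lattice window `{d : θ₁ R ≤ d ≤ θ₀ R}`.

This file records the cleanest known SUFFICIENT condition for WAL in exponent language
(`windowArchLocality_of_tailExponent`, registered as `stub_windowArchLocality_of_tailExponent`):
if for ONE exponent `α > 0`
* (far)  `Σ_{d ∈ S} FarMass^R_Λ(s_x → t_d) ≤ C R^{-α}` for all `R ≥ 1`, `Λ` in the rows `≥ x₁`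
  and `0 ∉ S` (endpoint-summed reach tail of the half-plane arch measure), and
* (near) `c m^{-α} ≤ Σ_{m ≤ d ≤ K m / 2} Z_{B⁺(K m)}(s_x → t_d)` for all `K ≥ K₀`, `m ≥ 1`
  (one-sided span-window mass inside the upper half-box of radius `K m`),
then WAL holds.  The proof is real-variable bookkeeping plus exact restriction: given `η` and
`θ₀ ≤ θb := 1`, choose `K ≥ max K₀ 2` with `(K/θ₀)^α ≥ C/(η c)`, put `θ₁ := θ₀ / K`,
`R₀ := max 1 θ₁⁻¹`, and for `R ≥ R₀` apply (far) at `R` and (near) at `m := θ₁ R` with the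
sub-window `{d ∈ S : d ≤ K m / 2}` and the sub-box `{v ∈ B : |c_v - mid s_x| ≤ K m}`
(`K m = θ₀ R ≤ R`); monotonicity of `Z` in the domain (`archMass_mono`) and in the window, and
`C R^{-α} ≤ η c (θ₁ R)^{-α}` by the choice of `K`, finish.
Sources: LawlerSchrammWerner2004SAW §3.4 ("SAW satisfies restriction") for the restriction
property; the exponent bookkeeping is folklore.
-/

noncomputable section

open scoped BigOperators Classical
open Literature.Probability.LatticeModels (HexVertex hexGraph hexCenter Site)
open Literature.Probability.RandomPlanarGeometry
open Literature.Probability.RandomPlanarGeometry.SAW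
open Summit.CriticalPhenomena.SAWScalingLimit.Theorems.ObservableToSLE.FloorRatio

namespace Summit.CriticalPhenomena.SAWScalingLimit.Theorems.HexConjecture.RootLocality

/-! ### Real-variable bookkeeping -/

/-- **Choice of the window ratio.**  For `α, C, c, η, θ₀ > 0` and any `K₀` there are `K ≥ max K₀ 2`
and `θ₁ > 0` with `K θ₁ = θ₀` and `C ≤ η c θ₁^{-α}`: take `K := max (max K₀ 2) (θ₀ L)` with
`L := (C/(η c))^{1/α}`, so that `θ₁^{-α} = (K/θ₀)^α ≥ L^α = C/(η c)`. [folklore] -/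
theorem exists_windowRatio_of_tailExponent {α C c η θ₀ : ℝ} (K₀ : ℝ) (hα : 0 < α) (hC : 0 < C)
    (hc : 0 < c) (hη : 0 < η) (hθ₀ : 0 < θ₀) :
    ∃ K θ₁ : ℝ, K₀ ≤ K ∧ 2 ≤ K ∧ 0 < θ₁ ∧ K * θ₁ = θ₀ ∧ C ≤ η * (c * θ₁ ^ (-α)) := by
  have hQ : 0 < C / (η * c) := div_pos hC (mul_pos hη hc)
  obtain ⟨L, hL0, hLα⟩ : ∃ L : ℝ, 0 ≤ L ∧ L ^ α = C / (η * c) :=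
    ⟨(C / (η * c)) ^ α⁻¹, Real.rpow_nonneg hQ.le _, Real.rpow_inv_rpow hQ.le hα.ne'⟩
  obtain ⟨K, hK₀K, hK2, hLK⟩ : ∃ K : ℝ, K₀ ≤ K ∧ 2 ≤ K ∧ θ₀ * L ≤ K :=
    ⟨max (max K₀ 2) (θ₀ * L), (le_max_left _ _).trans (le_max_left _ _),
      (le_max_right _ _).trans (le_max_left _ _), le_max_right _ _⟩
  have hK0 : 0 < K := by linarith
  refine ⟨K, θ₀ / K, hK₀K, hK2, div_pos hθ₀ hK0, mul_div_cancel₀ θ₀ hK0.ne', ?_⟩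
  have hLK' : L ≤ K / θ₀ := by
    rw [le_div_iff₀ hθ₀, mul_comm]
    exact hLK
  have hpow : C / (η * c) ≤ (K / θ₀) ^ α := by
    calc C / (η * c) = L ^ α := hLα.symm
      _ ≤ (K / θ₀) ^ α := Real.rpow_le_rpow hL0 hLK' hα.le
  have hneg : (θ₀ / K) ^ (-α) = (K / θ₀) ^ α := by
    rw [Real.rpow_neg (div_pos hθ₀ hK0).le, ← Real.inv_rpow (div_pos hθ₀ hK0).le, inv_div]
  rw [hneg]
  calc C = η * (c * (C / (η * c))) := by field_simp
    _ ≤ η * (c * (K / θ₀) ^ α) := by gcongr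

/-- **Scaling of the tail bound to the window scale.**  If `C ≤ η c θ₁^{-α}` then
`C R^{-α} ≤ η c (θ₁ R)^{-α}` for `θ₁, R ≥ 0`, since `(θ₁ R)^{-α} = θ₁^{-α} R^{-α}`. [folklore] -/
theorem tailBound_le_windowBound {α C c η θ₁ R : ℝ} (hθ₁ : 0 ≤ θ₁) (hR : 0 ≤ R)
    (h : C ≤ η * (c * θ₁ ^ (-α))) :
    C * R ^ (-α) ≤ η * (c * (θ₁ * R) ^ (-α)) := by
  rw [Real.mul_rpow hθ₁ hR]
  calc C * R ^ (-α) ≤ η * (c * θ₁ ^ (-α)) * R ^ (-α) :=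
      mul_le_mul_of_nonneg_right h (Real.rpow_nonneg hR _)
    _ = η * (c * (θ₁ ^ (-α) * R ^ (-α))) := by ring

/-! ### Sub-windows and sub-boxes -/

/-- The lattice window `{d : θ₁ R ≤ d ≤ θ₀ R}` does not contain the offset `0` as soon as
`θ₁ R > 0`. [folklore] -/
theorem zero_not_mem_window {S : Finset ℤ} {θ₀ θ₁ R : ℝ}
    (hS : ∀ d : ℤ, d ∈ S ↔ (θ₁ * R ≤ (d : ℝ) ∧ (d : ℝ) ≤ θ₀ * R)) (h : 0 < θ₁ * R) :
    (0 : ℤ) ∉ S := fun h0 => by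
  have h1 := ((hS 0).1 h0).1
  push_cast at h1
  linarith

/-- **The sub-window.**  For `S = {d : θ₁ R ≤ d ≤ θ₀ R}` and a cut-off `T ≤ θ₀ R`, the filtered
window `{d ∈ S : d ≤ T}` is `{d : θ₁ R ≤ d ≤ T}`. [folklore] -/
theorem mem_filter_window_iff {S : Finset ℤ} {θ₀ θ₁ R T : ℝ}
    (hS : ∀ d : ℤ, d ∈ S ↔ (θ₁ * R ≤ (d : ℝ) ∧ (d : ℝ) ≤ θ₀ * R)) (hT : T ≤ θ₀ * R) (d : ℤ) :
    d ∈ S.filter (fun d : ℤ => (d : ℝ) ≤ T) ↔ (θ₁ * R ≤ (d : ℝ) ∧ (d : ℝ) ≤ T) := by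
  rw [Finset.mem_filter, hS]
  exact ⟨fun h => ⟨h.1.1, h.2⟩, fun h => ⟨⟨h.1, h.2.trans hT⟩, h.2⟩⟩

/-- **The sub-box.**  If `B` is the part of the rows `≥ x₁` within distance `R` of `mid s_x` and
`T ≤ R`, then `{v ∈ B : |c_v - mid s_x| ≤ T}` is the part of the rows `≥ x₁` within distance `T`
of `mid s_x`. [folklore] -/
theorem mem_filter_halfBox_iff {B : Finset HexVertex} {x : Site 2} {R T : ℝ}
    (hB : ∀ v : HexVertex, v ∈ B ↔ (x 1 ≤ v.1 1 ∧
      dist (hexCenter v) (hexMidpoint s((x - Pi.single 1 1, 1), (x, 0))) ≤ R))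
    (hT : T ≤ R) (v : HexVertex) :
    v ∈ B.filter (fun v : HexVertex =>
        dist (hexCenter v) (hexMidpoint s((x - Pi.single 1 1, 1), (x, 0))) ≤ T) ↔
      (x 1 ≤ v.1 1 ∧ dist (hexCenter v) (hexMidpoint s((x - Pi.single 1 1, 1), (x, 0))) ≤ T) := by
  rw [Finset.mem_filter, hB]
  exact ⟨fun h => ⟨h.1.1, h.2⟩, fun h => ⟨⟨h.1, h.2.trans hT⟩, h.2⟩⟩

/-- **The window mass is monotone in the box and in the window** (exact restriction
`archMass_mono` termwise, and nonnegativity of the arch masses): for `B' ⊆ B` and `S' ⊆ S`,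
`Σ_{d ∈ S'} Z_{B'}(s → t_d) ≤ Σ_{d ∈ S} Z_B(s → t_d)`. [cite: LawlerSchrammWerner2004SAW, §3.4 ("SAW satisfies restriction")] -/
theorem windowArchMass_mono {B B' : Finset HexVertex} (hB : B' ⊆ B) {S S' : Finset ℤ}
    (hS : S' ⊆ S) (s : Sym2 HexVertex) (t : ℤ → Sym2 HexVertex) :
    ∑ d ∈ S', ∑ γ : HexMidEdgeSAW B' s (t d), hexCriticalFugacity ^ γ.length ≤
      ∑ d ∈ S, ∑ γ : HexMidEdgeSAW B s (t d), hexCriticalFugacity ^ γ.length :=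
  calc ∑ d ∈ S', ∑ γ : HexMidEdgeSAW B' s (t d), hexCriticalFugacity ^ γ.length
      ≤ ∑ d ∈ S', ∑ γ : HexMidEdgeSAW B s (t d), hexCriticalFugacity ^ γ.length :=
        Finset.sum_le_sum fun _ _ => archMass_mono hB _ _
    _ ≤ _ := Finset.sum_le_sum_of_subset_of_nonneg hS fun _ _ _ => archMass_nonneg _ _ _

/-! ### The theorem -/

/-- **A COMMON TAIL EXPONENT OF THE HALF-PLANE ARCH MEASURE IMPLIES WINDOW-AVERAGED ARCH
LOCALITY.**  Hypothesis (H): there are `α, C, c, K₀ > 0` with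
(far) `Σ_{d ∈ S} FarMass^R_Λ(s_x → t_d) ≤ C R^{-α}` for all `R ≥ 1`, every cell `x`, every finite
`Λ` in the rows `≥ x₁` and every finite `S ∌ 0`, and
(near) `c m^{-α} ≤ Σ_{d ∈ S} Z_B(s_x → t_d)` for all `K ≥ K₀`, `m ≥ 1`, `B` the part of the rows
`≥ x₁` within distance `K m` of `mid s_x` and `S = {d : m ≤ d ≤ K m / 2}`.
Conclusion: WAL, with `θb := 1`, `θ₁ := θ₀ / K` for the `K = K(η, θ₀) ≥ max K₀ 2` of
`exists_windowRatio_of_tailExponent`, and `R₀ := max 1 θ₁⁻¹`.  For `R ≥ R₀` one has `R ≥ 1`,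
`m := θ₁ R ≥ 1`, `0 ∉ S`, so (far) bounds the left side by `C R^{-α}`; (near) at
`(K, m, x, {v ∈ B : |c_v - mid s_x| ≤ K m}, {d ∈ S : d ≤ K m / 2})` (legitimate since
`K m = θ₀ R ≤ R` and `K m / 2 ≤ θ₀ R`) and monotonicity (`windowArchMass_mono`) bound
`c m^{-α}` by the window mass `Σ_{d ∈ S} Z_B(s_x → t_d)`; and `C R^{-α} ≤ η c m^{-α}`
(`tailBound_le_windowBound`). [cite: LawlerSchrammWerner2004SAW, §3.4 ("SAW satisfies restriction")] -/
theorem windowArchLocality_of_tailExponent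
    (H : ∃ α C c K₀ : ℝ, 0 < α ∧ 0 < C ∧ 0 < c ∧ 0 < K₀ ∧
      (∀ R : ℝ, 1 ≤ R → ∀ (x : Site 2) (Λ : Finset HexVertex), (∀ v ∈ Λ, x 1 ≤ v.1 1) →
        ∀ S : Finset ℤ, (0 : ℤ) ∉ S →
        ∑ d ∈ S, (∑ γ : HexMidEdgeSAW Λ s((x - Pi.single 1 1, 1), (x, 0))
            s((x + Pi.single 0 d - Pi.single 1 1, 1), (x + Pi.single 0 d, 0)),
          if ∃ v ∈ γ.verts, R ≤ dist (hexCenter v) (hexMidpoint s((x - Pi.single 1 1, 1), (x, 0)))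
          then hexCriticalFugacity ^ γ.length else 0) ≤ C * R ^ (-α)) ∧
      (∀ K : ℝ, K₀ ≤ K → ∀ m : ℝ, 1 ≤ m → ∀ (x : Site 2) (B : Finset HexVertex),
        (∀ v : HexVertex, v ∈ B ↔ (x 1 ≤ v.1 1 ∧
          dist (hexCenter v) (hexMidpoint s((x - Pi.single 1 1, 1), (x, 0))) ≤ K * m)) →
        ∀ S : Finset ℤ, (∀ d : ℤ, d ∈ S ↔ (m ≤ (d : ℝ) ∧ (d : ℝ) ≤ K * m / 2)) →
        c * m ^ (-α) ≤ ∑ d ∈ S, ∑ γ : HexMidEdgeSAW B s((x - Pi.single 1 1, 1), (x, 0))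
            s((x + Pi.single 0 d - Pi.single 1 1, 1), (x + Pi.single 0 d, 0)),
          hexCriticalFugacity ^ γ.length)) :
    ∀ η : ℝ, 0 < η → ∃ θb : ℝ, 0 < θb ∧ ∀ θ₀ : ℝ, 0 < θ₀ → θ₀ ≤ θb →
    ∃ θ₁ : ℝ, 0 < θ₁ ∧ θ₁ < θ₀ ∧ ∃ R₀ : ℝ, 0 < R₀ ∧ ∀ R : ℝ, R₀ ≤ R →
    ∀ (x : Site 2) (Λ B : Finset HexVertex) (S : Finset ℤ),
      (∀ v ∈ Λ, x 1 ≤ v.1 1) →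
      (∀ v : HexVertex, v ∈ B ↔ (x 1 ≤ v.1 1 ∧
        dist (hexCenter v) (hexMidpoint s((x - Pi.single 1 1, 1), (x, 0))) ≤ R)) →
      (∀ d : ℤ, d ∈ S ↔ (θ₁ * R ≤ (d : ℝ) ∧ (d : ℝ) ≤ θ₀ * R)) →
      ∑ d ∈ S, (∑ γ : HexMidEdgeSAW Λ s((x - Pi.single 1 1, 1), (x, 0))
          s((x + Pi.single 0 d - Pi.single 1 1, 1), (x + Pi.single 0 d, 0)),
        if ∃ v ∈ γ.verts, R ≤ dist (hexCenter v) (hexMidpoint s((x - Pi.single 1 1, 1), (x, 0)))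
        then hexCriticalFugacity ^ γ.length else 0) ≤
      η * ∑ d ∈ S, ∑ γ : HexMidEdgeSAW B s((x - Pi.single 1 1, 1), (x, 0))
          s((x + Pi.single 0 d - Pi.single 1 1, 1), (x + Pi.single 0 d, 0)),
        hexCriticalFugacity ^ γ.length := by
  obtain ⟨α, C, c, K₀, hα, hC, hc, -, Hfar, Hnear⟩ := H
  intro η hη
  refine ⟨1, one_pos, fun θ₀ hθ₀ hθ₀1 => ?_⟩
  obtain ⟨K, θ₁, hK₀K, hK2, hθ₁, hKθ, hCle⟩ :=
    exists_windowRatio_of_tailExponent K₀ hα hC hc hη hθ₀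
  have hθ₁θ₀ : θ₁ < θ₀ :=
    calc θ₁ < 2 * θ₁ := by linarith
      _ ≤ K * θ₁ := mul_le_mul_of_nonneg_right hK2 hθ₁.le
      _ = θ₀ := hKθ
  refine ⟨θ₁, hθ₁, hθ₁θ₀, max 1 θ₁⁻¹, lt_max_iff.2 (Or.inl one_pos),
    fun R hR x Λ B S hΛ hB hS => ?_⟩
  have hR1 : 1 ≤ R := (le_max_left _ _).trans hR
  have hR0 : 0 ≤ R := zero_le_one.trans hR1
  -- the window scale `m := θ₁ R ≥ 1`
  have hm : 1 ≤ θ₁ * R :=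
    calc (1 : ℝ) = θ₁ * θ₁⁻¹ := (mul_inv_cancel₀ hθ₁.ne').symm
      _ ≤ θ₁ * R := mul_le_mul_of_nonneg_left ((le_max_right _ _).trans hR) hθ₁.le
  have hKm : K * (θ₁ * R) = θ₀ * R := by rw [← mul_assoc, hKθ]
  have hKmR : K * (θ₁ * R) ≤ R := by
    rw [hKm]
    exact mul_le_of_le_one_left hR0 hθ₀1
  have hKm2 : K * (θ₁ * R) / 2 ≤ θ₀ * R := by
    rw [hKm]
    linarith [mul_nonneg hθ₀.le hR0]
  -- (far) at `R`, (near) at `(K, θ₁ R)` with the sub-box and the sub-window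
  have hLHS := Hfar R hR1 x Λ hΛ S (zero_not_mem_window hS (by linarith))
  have hRHS := Hnear K hK₀K (θ₁ * R) hm x _ (mem_filter_halfBox_iff hB hKmR) _
    (mem_filter_window_iff hS hKm2)
  calc _ ≤ C * R ^ (-α) := hLHS
    _ ≤ η * (c * (θ₁ * R) ^ (-α)) := tailBound_le_windowBound hθ₁.le hR0 hCle
    _ ≤ _ := mul_le_mul_of_nonneg_left (hRHS.trans (windowArchMass_mono
        (Finset.filter_subset _ _) (Finset.filter_subset _ _) _ _)) hη.le

/-- **Registered sub-goal `stub_windowArchLocality_of_tailExponent`** (crux item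
stmt-CriticalPhenomena-0808, line `root-locality-replaces-loewner`, c5): a common tail exponent of
the critical half-plane arch measure — endpoint-summed reach tail `≤ C R^{-α}` and one-sided
span-window mass `≥ c m^{-α}` in the half-box of radius `K m`, for the SAME `α` — implies the
window-averaged arch locality `stub_windowArchLocality` (WAL)
(`windowArchLocality_of_tailExponent`). [cite: LawlerSchrammWerner2004SAW, §3.4 ("SAW satisfies restriction")] -/
theorem stub_windowArchLocality_of_tailExponent : (∃ α C c K₀ : ℝ, 0 < α ∧ 0 < C ∧ 0 < c ∧ 0 < K₀ ∧ (∀ R : ℝ, 1 ≤ R → ∀ (x : Literature.Probability.LatticeModels.Site 2) (Λ : Finset Literature.Probability.LatticeModels.HexVertex), (∀ v ∈ Λ, x 1 ≤ v.1 1) → ∀ S : Finset ℤ, (0 : ℤ) ∉ S → ∑ d ∈ S, (∑ γ : Literature.Probability.RandomPlanarGeometry.SAW.HexMidEdgeSAW Λ s((x - Pi.single 1 1, 1), (x, 0)) s((x + Pi.single 0 d - Pi.single 1 1, 1), (x + Pi.single 0 d, 0)), if ∃ v ∈ γ.verts, R ≤ dist (Literature.Probability.LatticeModels.hexCenter v)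 (Literature.Probability.RandomPlanarGeometry.SAW.hexMidpoint s((x - Pi.single 1 1, 1), (x, 0))) then Literature.Probability.RandomPlanarGeometry.SAW.hexCriticalFugacity ^ γ.length else 0) ≤ C * R ^ (-α)) ∧ (∀ K : ℝ, K₀ ≤ K → ∀ m : ℝ, 1 ≤ m → ∀ (x : Literature.Probability.LatticeModels.Site 2) (B : Finset Literature.Probability.LatticeModels.HexVertex), (∀ v : Literature.Probability.LatticeModels.HexVertex, v ∈ B ↔ (x 1 ≤ v.1 1 ∧ dist (Literature.Probability.LatticeModels.hexCenter v) (Literature.Probability.RandomPlanarGeometry.SAW.hexMidpoint s((x - Pi.single 1 1, 1), (x, 0))) ≤ K * m)) → ∀ S : Finset ℤ, (∀ d : ℤ, d ∈ S ↔ (m ≤ (d : ℝ) ∧ (d : ℝ) ≤ K * m / 2)) → c * m ^ (-α) ≤ ∑ d ∈ S, ∑ γ : Literature.Probability.RandomPlanarGeometry.SAW.HexMidEdgeSAW B s((x - Pi.single 1 1, 1), (x, 0)) s((x + Pi.single 0 d - Pi.single 1 1, 1), (x + Pi.single 0 d, 0)), Literature.Probability.RandomPlanarGeometry.SAW.hexCriticalFugacity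 ^ γ.length)) → (∀ η : ℝ, 0 < η → ∃ θb : ℝ, 0 < θb ∧ ∀ θ₀ : ℝ, 0 < θ₀ → θ₀ ≤ θb → ∃ θ₁ : ℝ, 0 < θ₁ ∧ θ₁ < θ₀ ∧ ∃ R₀ : ℝ, 0 < R₀ ∧ ∀ R : ℝ, R₀ ≤ R → ∀ (x : Literature.Probability.LatticeModels.Site 2) (Λ B : Finset Literature.Probability.LatticeModels.HexVertex) (S : Finset ℤ), (∀ v ∈ Λ, x 1 ≤ v.1 1) → (∀ v : Literature.Probability.LatticeModels.HexVertex, v ∈ B ↔ (x 1 ≤ v.1 1 ∧ dist (Literature.Probability.LatticeModels.hexCenter v) (Literature.Probability.RandomPlanarGeometry.SAW.hexMidpoint s((x - Pi.single 1 1, 1), (x, 0))) ≤ R)) → (∀ d : ℤ, d ∈ S ↔ (θ₁ * R ≤ (d : ℝ) ∧ (d : ℝ) ≤ θ₀ * R)) → ∑ d ∈ S, (∑ γ : Literature.Probability.RandomPlanarGeometry.SAW.HexMidEdgeSAW Λ s((x - Pi.single 1 1, 1), (x, 0)) s((x + Pi.single 0 d - Pi.single 1 1, 1), (x + Pi.single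 0 d, 0)), if ∃ v ∈ γ.verts, R ≤ dist (Literature.Probability.LatticeModels.hexCenter v) (Literature.Probability.RandomPlanarGeometry.SAW.hexMidpoint s((x - Pi.single 1 1, 1), (x, 0))) then Literature.Probability.RandomPlanarGeometry.SAW.hexCriticalFugacity ^ γ.length else 0) ≤ η * ∑ d ∈ S, ∑ γ : Literature.Probability.RandomPlanarGeometry.SAW.HexMidEdgeSAW B s((x - Pi.single 1 1, 1), (x, 0)) s((x + Pi.single 0 d - Pi.single 1 1, 1), (x + Pi.single 0 d, 0)), Literature.Probability.RandomPlanarGeometry.SAW.hexCriticalFugacity ^ γ.length) :=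
  windowArchLocality_of_tailExponent

end Summit.CriticalPhenomena.SAWScalingLimit.Theorems.HexConjecture.RootLocality

end
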